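import Mathlib
import HarnessLib
import Literature.Analysis.FluidPDE.TypeIAncientMild
import Literature.Analysis.FluidPDE.LocalTypeI
import Literature.Analysis.FluidPDE.VectorCalculus

/-!
# AxisTwistDoor · crux `TiltDominationLoc` (stmt-NavierStokesRegularity-26991) — VOCABULARY of the line «signcone»
# (route-posited objects of a registered-line skeleton, CONVENTIONS §1 `<RouteSlug>Defs.lean`)

Definitions only (no theorems).  VERBATIM port of the Props of ns-idea-6 g7's line file
`pub/ideators/ns-idea-6/lines/AxisTwistDoor/TiltDominationLoc_signcone_birth.lean` (sha16 `5030b09f675da547`, idea-crit-4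
PASS 2026-08-28T15:44Z; AUTHOR OF THE MATHEMATICS: planner seat ns-idea-6 g7; this seat only lands the texts so that the
line's stubs can be proved and cited BY NAME from `Theorems/`; keyed by DIRECTOR-NS #244 (4)).  The planner's file declares
them in `namespace …Cruxes.TiltDominationLoc.SignCone`, which is not importable from `Theorems/`.

The line («assume the opposite — build the counterexample until it breaks»).  If `TiltDominationLoc` fails, the PROVED
dictionary (`…TiltDominationLocRigidity.tiltDominationLoc_iff_oneSignedRigidity`,
`…TiltDominationLocEnergyClass.oneSignedRigidity_iff_core`) yields a CORE PROFILE (`IsCore`) with one-signed vertical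
vorticity `ω₃ ≥ 0` on the backward slab, backward-singular at the apex.  NEW OBJECT: the SIGN CONE `SignCone v` of a
profile — all `e` with `⟪curl v(s) y, e⟫ ≥ 0` on the whole slab (a closed convex cone, the dual cone of the vorticity
values; `e₃ ∈ SignCone v` is the crux hypothesis).  The crux is organised by the dimension of the span of the sign cone of
an EXTREMAL counterexample: span 3 = the Lei–Ren–Tian cone hypothesis (KNOWN rung: `AveragedConeLiouville` 26889 +
`RotationToAxis` 24348, both PROVED); span 2 = the NEW RUNG `StubDihedralRigidity`; span 1 = the generic case, first
pushed to a SIGN-SATURATED element (`IsSignSaturated`, `StubSaturatedElement`: every direction one-signed on SOME apex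
cylinder is one-signed on the whole slab), then THE WALL `StubRayRigidity`.  The shared poloidal node is the tree's
`…AxisTwistDoorTiltDominationLocDefs.StubNoPlanarCollar` (not restated here).

WHAT THIS IS NOT: no theorem is proved here and none of these Props is asserted; `StubRayRigidity` is the crux restricted
to saturated ray-cone profiles — the SAME WALL as 26991 (W3 of the NS wall board), not a smaller problem;
`TiltDominationLoc`, the leaf `HalfSpaceWindowDoor.Target` and Navier–Stokes regularity (Clay A) are OPEN.  Every
statement concerns HYPOTHETICAL Type-I blow-up profiles.  Landing seat ns-imp-p1 g5 (LEAD of record on 26991: ns-atd-p1).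
-/

noncomputable section

-- the summit and its single sub-problem share the name (CONVENTIONS §1), as in every Theorems file
set_option linter.dupNamespace false

namespace Summit.NavierStokesRegularity.NavierStokesRegularity.Theorems.AxisTwistDoorSignConeDefs

open MeasureTheory Set Function Filter Topology
open scoped InnerProductSpace RealInnerProductSpace
open Literature.Analysis Literature.Analysis.FluidPDE

/-- The CORE CLASS of the dictionary (`oneSignedRigidity_iff_core`; birth file, verbatim): Type-I rate in time,
continuity on the open backward slab, the Oseen–Duhamel (KNSS-mild) identity at unit viscosity, divergence-free slices.
(Smoothness, the scale-invariant energies and the global energy class are AUTOMATIC here —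
`…TiltDominationLocEnergyClass.exists_energyClass_of_typeI`.) -/
def IsCore (C : ℝ) (v : ℝ → EuclideanSpace ℝ (Fin 3) → EuclideanSpace ℝ (Fin 3)) : Prop :=
  HasTypeITimeDecay C v ∧
    ContinuousOn (uncurry v) (Iio (0 : ℝ) ×ˢ univ) ∧
    (∀ s t : ℝ, s < t → t < 0 → ∀ x,
        v t x = UnboundedOperators.heatExtension (v s) (t - s) x - oseenDuhamel 1 s v v t x) ∧
    (∀ t < 0, VectorCalculus.IsDivFree (v t))

/-- NEW OBJECT (birth file, verbatim): the SIGN CONE of a profile — all vectors `e` against which the vorticity is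
everywhere non-negative on the backward slab (a closed convex cone; `e₃ ∈ SignCone v` is the crux's hypothesis
`ω₃ ≥ 0`). -/
def SignCone (v : ℝ → EuclideanSpace ℝ (Fin 3) → EuclideanSpace ℝ (Fin 3)) :
    Set (EuclideanSpace ℝ (Fin 3)) :=
  {e | ∀ s < 0, ∀ y : EuclideanSpace ℝ (Fin 3), 0 ≤ ⟪curl (v s) y, e⟫_ℝ}

/-- SIGN-SATURATION (birth file, verbatim): every direction against which the vorticity is non-negative on SOME apex
cylinder `Q(ρ) = (−ρ², 0) × B(0, ρ)` is non-negative on the whole slab. -/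
def IsSignSaturated (v : ℝ → EuclideanSpace ℝ (Fin 3) → EuclideanSpace ℝ (Fin 3)) : Prop :=
  ∀ e : EuclideanSpace ℝ (Fin 3),
    (∃ ρ : ℝ, 0 < ρ ∧ ∀ s : ℝ, -ρ ^ 2 < s → s < 0 →
        ∀ y : EuclideanSpace ℝ (Fin 3), ‖y‖ < ρ → 0 ≤ ⟪curl (v s) y, e⟫_ℝ) →
      e ∈ SignCone v

/-- PUSH (size M–L; birth file, verbatim).  SATURATED ELEMENT: if a backward-singular core profile with `ω₃ ≥ 0` exists,
a SIGN-SATURATED one exists (compactness of the class, sign preservation under apex zooms, persistence of the apex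
singularity along zoom-in limits, and an extremal element of the apex-scaling dynamics).  Statement of the registered stub
`stub_saturatedElement`. -/
def StubSaturatedElement : Prop :=
  (∃ (C : ℝ) (v : ℝ → EuclideanSpace ℝ (Fin 3) → EuclideanSpace ℝ (Fin 3)),
      IsCore C v ∧ EuclideanSpace.single (2 : Fin 3) (1 : ℝ) ∈ SignCone v ∧ IsBackwardSingularPoint v 0) →
    ∃ (C : ℝ) (w : ℝ → EuclideanSpace ℝ (Fin 3) → EuclideanSpace ℝ (Fin 3)),
      IsCore C w ∧ EuclideanSpace.single (2 : Fin 3) (1 : ℝ) ∈ SignCone w ∧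
        IsBackwardSingularPoint w 0 ∧ IsSignSaturated w

/-- NEW RUNG (size L–XL, strictly between the cone theorem and the crux; birth file, verbatim).  DIHEDRAL RIGIDITY: a core
profile with TWO linearly independent one-signed vorticity directions — `ω₃ ≥ 0` and `⟪ω, e⟫ ≥ 0` with `e ∉ ℝ e₃`, i.e.
vorticity pointwise in a dihedral wedge of opening `< π` — is not backward-singular at the apex.  (Contains the
Lei–Ren–Tian cone theorem as the sub-case of an open sign cone; degenerates to poloidal rigidity as `e → −e₃`.)
Statement of the registered stub `stub_dihedralRigidity`. -/
def StubDihedralRigidity : Prop :=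
  ∀ (C : ℝ) (w : ℝ → EuclideanSpace ℝ (Fin 3) → EuclideanSpace ℝ (Fin 3)),
    IsCore C w → EuclideanSpace.single (2 : Fin 3) (1 : ℝ) ∈ SignCone w →
      ∀ e ∈ SignCone w, (∀ c : ℝ, e ≠ c • EuclideanSpace.single (2 : Fin 3) (1 : ℝ)) →
        ¬ IsBackwardSingularPoint w 0

/-- THE WALL (size XL, the line's bet; birth file, verbatim).  RAY RIGIDITY: a one-signed core profile for which EVERY
direction that is one-signed on some apex cylinder is a non-negative multiple of `e₃` (a saturated profile with ray sign
cone: the tilt `ω_h/ω₃` is unbounded in every horizontal direction, both orientations, at every scale) is not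
backward-singular at the apex.  HONEST LABEL (idea-crit-4 N1): this is crux 26991 on the saturated ray-cone subclass —
the same wall as the crux, with new structure; nobody should count it as a smaller problem.  Statement of the stub
`stub_rayRigidity` (no prover is keyed to it: SAME-WALL rule). -/
def StubRayRigidity : Prop :=
  ∀ (C : ℝ) (w : ℝ → EuclideanSpace ℝ (Fin 3) → EuclideanSpace ℝ (Fin 3)),
    IsCore C w → EuclideanSpace.single (2 : Fin 3) (1 : ℝ) ∈ SignCone w →
      (∀ e : EuclideanSpace ℝ (Fin 3),
          (∃ ρ : ℝ, 0 < ρ ∧ ∀ s : ℝ, -ρ ^ 2 < s → s < 0 →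
              ∀ y : EuclideanSpace ℝ (Fin 3), ‖y‖ < ρ → 0 ≤ ⟪curl (w s) y, e⟫_ℝ) →
            ∃ c : ℝ, 0 ≤ c ∧ e = c • EuclideanSpace.single (2 : Fin 3) (1 : ℝ)) →
        ¬ IsBackwardSingularPoint w 0

/-! ### Appended by the LEAD (ns-atd-p1 g4, reshapes v3/v4 of line `signcone`): the rungs replacing `StubDihedralRigidity` -/

/-- PLANAR-WEDGE RIGIDITY (reshape v3 of line `signcone`, LEAD ns-atd-p1 g4; director-ns #250): the dihedral rung with the
extra hypothesis that the sign cone has EMPTY INTERIOR (its dimension-3 complement is PROVED: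
`…AxisTwistDoorSignConeInterior.not_isBackwardSingularPoint_of_interior_signCone_nonempty`), i.e. — a closed convex cone of
`ℝ³` with empty interior lies in a plane — the sign cone is a planar wedge in `span{e₃, e}`.  Statement of the registered stub
`stub_planarWedgeRigidity` (v3); from v4 on it is DERIVED from `StubProperWedgeRigidity` and W4 rotated. -/
def StubPlanarWedgeRigidity : Prop :=
  ∀ (C : ℝ) (w : ℝ → EuclideanSpace ℝ (Fin 3) → EuclideanSpace ℝ (Fin 3)),
    IsCore C w → EuclideanSpace.single (2 : Fin 3) (1 : ℝ) ∈ SignCone w →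
      ∀ e ∈ SignCone w, (∀ c : ℝ, e ≠ c • EuclideanSpace.single (2 : Fin 3) (1 : ℝ)) →
        interior (SignCone w) = ∅ → ¬ IsBackwardSingularPoint w 0

/-- PROPER-WEDGE RIGIDITY (reshape v4 of line `signcone`, LEAD ns-atd-p1 g4): the planar-wedge rung with the further
hypothesis that the sign cone is POINTED (contains no line: `f ∈ K → −f ∈ K → f = 0`); then `K` is a proper wedge in the
plane `span{e₃, e}` with two extreme rays, the vorticity lies pointwise in the dual dihedral wedge with its component along
the normal `e₃ × e` free (and, after saturation, sign-changing in every apex cylinder).  The complementary case «`K`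
contains a line `ℝf`» means `⟪ω, f⟫ ≡ 0` (poloidal in direction `f`) and is W4 rotated to `f`.  Size L–XL, research — the
honest residue of the dihedral rung.  Statement of the registered stub `stub_properWedgeRigidity` (v4). -/
def StubProperWedgeRigidity : Prop :=
  ∀ (C : ℝ) (w : ℝ → EuclideanSpace ℝ (Fin 3) → EuclideanSpace ℝ (Fin 3)),
    IsCore C w → EuclideanSpace.single (2 : Fin 3) (1 : ℝ) ∈ SignCone w →
      ∀ e ∈ SignCone w, (∀ c : ℝ, e ≠ c • EuclideanSpace.single (2 : Fin 3) (1 : ℝ)) →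
        interior (SignCone w) = ∅ → (∀ f : EuclideanSpace ℝ (Fin 3), f ∈ SignCone w → -f ∈ SignCone w → f = 0) →
          ¬ IsBackwardSingularPoint w 0

/-- PROPER-WEDGE RIGIDITY, SATURATED FORM (reshape v6 of line `signcone`, LEAD ns-atd-p1 g4): `StubProperWedgeRigidity`
with the extra hypothesis `IsSignSaturated w` — free of charge in the line's composition, which saturates the
counterexample FIRST (`StubSaturatedElement`, PROVED p650488) and only then splits by the sign cone; strictly weaker
than `StubProperWedgeRigidity`.  With saturation every direction off the planar wedge `K` — in particular both normals
of its plane and every in-plane direction outside the wedge — is TWO-SIGNED in every apex cylinder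
(`…SignConeToolkit.twoSigned_inner_curl_of_saturated`).  Statement of the registered stub `stub_properWedgeRigiditySat`
(v6).  Size L–XL, research. -/
def StubProperWedgeRigiditySat : Prop :=
  ∀ (C : ℝ) (w : ℝ → EuclideanSpace ℝ (Fin 3) → EuclideanSpace ℝ (Fin 3)),
    IsCore C w → EuclideanSpace.single (2 : Fin 3) (1 : ℝ) ∈ SignCone w → IsSignSaturated w →
      ∀ e ∈ SignCone w, (∀ c : ℝ, e ≠ c • EuclideanSpace.single (2 : Fin 3) (1 : ℝ)) →
        interior (SignCone w) = ∅ → (∀ f : EuclideanSpace ℝ (Fin 3), f ∈ SignCone w → -f ∈ SignCone w → f = 0) →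
          ¬ IsBackwardSingularPoint w 0

end Summit.NavierStokesRegularity.NavierStokesRegularity.Theorems.AxisTwistDoorSignConeDefs

end
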